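import Summits.BirchSwinnertonDyer.BirchSwinnertonDyer.Theorems.SylvesterTwoHeegnerIndexUpperOffV0StepBShear
import Literature.NumberTheory.EllipticCurves.HeegnerPointsKolyvaginPrimaryDescentProofs
import HarnessLib

/-!
# K7t crux `UpperOffV0HSY` (item 19581): McCallum's Cor. 3.2 at `p = 2` WITH A SHEAR — the extra
# Čebotarev instance `hceb₁` of the parity-free descent, for the CM curves `y² = x³ − c`

Route `SylvesterTwoHeegnerIndex` (cell bsd-cm, rung K7t), line `offv0-kolyvagin2` on
stmt-BirchSwinnertonDyer-19581; continues `…UpperOffV0StepBShear`.  For every `ℚ`-model `W` of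
`y² = x³ − c` over an imaginary quadratic field `K` with `∛c ∉ K`, `ω ∉ K`:

* `exists_kolyvaginPrime_gt_twoPow_shear` (+ `_holds`, Čebotarev discharged by the tree's
  `Automorphic.chebotarev_artinRep_holds`) — **Cor. 3.2 at `2` with a shear**: `c`-eigenclasses
  whose family sheared along a member with target `2^0` is McCallum-independent acquire prescribed
  local orders at infinitely many Kolyvagin primes (Step B with a shear + the tree's `p`-independent
  Steps C–G `exists_kolyvaginPrime_gt_of_galoisElement`);
* `exists_kolyvaginPrime_gt_twoPow_socle` — **the socle configuration of Claim B** (the Galois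
  content of `hceb₁` in `…DescentDefect.claimB_indep_defect'` / `descent_defect'`): for
  `c`-eigenclasses `x, s ∈ H¹(K, E[2^M])^{ε}`, `d ∈ H¹(K, E[2^M])^{-ε}` with `ℤ x ∩ ℤ s = 0`,
  `2^{M-1} x ≠ 0`, `ord s = 2^N` (`N ≠ 0`), `2^k d = 0`, `k ≥ 2` and the SOCLE RELATION
  `2^{k-1} d = u · 2^{M-1} x` (`u` odd — possible only at `2`, where opposite eigenclasses may meet),
  above every bound a prime `ℓ'` (`ℓ' ∤ 2 N d_K`, inert, `Frob(ℓ') = Frob(∞)` on `K(E[2^M])`) with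
  `x_{λ'} = 0`, `2^{N-1} s_{λ'} ≠ 0`, `2^{k-2} d_{λ'} ≠ 0` — because the sheared family
  `{x, s, d − u 2^{M-k} x}` is McCallum-independent with exponents `(M, N, k − 1)`.

NOT the crux: with `…DescentDefect` this closes the Čebotarev side of the generic 2-adic count
(`2^{2M₀+4}`); the duality at `2` (Lemma 5.3 with defect `1`), the instantiation from (d)(e), and
the sharp ORDER bound (B14 = O12, open as a class) remain.
-/

noncomputable section

open scoped Classical
open Field WeierstrassCurve NumberField IsDedekindDomain Literature.NumberTheory.EllipticCurves
  Literature.NumberTheory.GaloisRepresentations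

set_option autoImplicit false
set_option linter.dupNamespace false

namespace Summit.BirchSwinnertonDyer.BirchSwinnertonDyer.Theorems.SylvesterTwoUpper

universe u

/-! ## §2 Cor. 3.2 at `2` with a shear -/

variable {K : Type u} [Field K] [NumberField K]

/-- **McCallum 1991, Cor. 3.2 at `p = 2` for `E_W : y² = x³ − c` over `K` imaginary quadratic with
`∛c ∉ K`, `ω ∉ K`, WITH A SHEAR** (given Čebotarev): `c`-eigenclasses `c_i ∈ H¹(K, E[2^M])` whose
sheared family `c_i − a_i c_{i₀}` (`a_{i₀} = 0`) is McCallum-independent with exponents `e_i`, and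
targets `N_i ≤ min(e_i, M)` with `N_{i₀} = 0`, acquire above every bound `b` a prime `ℓ ∤ 2 N d_K`,
inert in `K`, with `Frob(ℓ) = Frob(∞)` in `Gal(K(E_{2^M})/ℚ)` and `ord c_{i,λ} = 2^{N_i}` exactly at
`λ ∋ ℓ`.  `exists_h1Eval_conj_mul_order_two_shear` + the tree's Steps C–G
(`exists_kolyvaginPrime_gt_of_galoisElement`). [cite: McCallumLMS1991, §3 Cor. 3.2] -/
theorem exists_kolyvaginPrime_gt_twoPow_shear (hC : Literature.NumberTheory.Automorphic.chebotarev_artinRep)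
    {N : ℕ} [NeZero N]
    (W : WeierstrassCurve ℚ) [W.IsElliptic] {C : VariableChange ℚ} {c : ℚ}
    (hCW : C • W = ⟨0, 0, 0, 0, -c⟩) (hK : IsImaginaryQuadratic K)
    (hc : ∀ x : K, x ^ 3 ≠ (c : K)) (hωK : ∀ x : K, x ^ 2 + x + 1 ≠ 0)
    {M : ℕ} (hM : 1 ≤ M) {cK : K ≃ₐ[ℚ] K} (hcK : cK ≠ 1) {r : ℕ}
    (cs : Fin r → galH1Torsion (W.baseChange K) ((2 ^ M : ℕ) : ℤ))
    (hτ : ∀ i, ∃ e : ℤ, (e = 1 ∨ e = -1) ∧ conjAct W cK ((2 ^ M : ℕ) : ℤ) (cs i) = e • cs i)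
    (i₀ : Fin r) (a : Fin r → ℤ) (ha : a i₀ = 0)
    (ex : Fin r → ℕ) (hex : ∀ i, ((2 : ℤ) ^ ex i) • (cs i - a i • cs i₀) = 0)
    (hind : ∀ b : Fin r → ℤ, ∑ i, b i • (cs i - a i • cs i₀) = 0 → ∀ i, ((2 : ℤ) ^ ex i) ∣ b i)
    (Nv : Fin r → ℕ) (hNe : ∀ i, Nv i ≤ ex i) (hNM : ∀ i, Nv i ≤ M) (hN₀ : Nv i₀ = 0) (b : ℕ) :
    ∃ ℓ : ℕ, b < ℓ ∧ ℓ.Prime ∧ ¬ ℓ ∣ N ∧ ¬ ((ℓ : ℤ) ∣ NumberField.discr K) ∧ ℓ ≠ 2 ∧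
      (Ideal.span {(ℓ : 𝓞 K)}).IsPrime ∧ FrobEqFrobInfty W K (2 ^ M) ℓ ∧
      ∀ i, ∀ v : HeightOneSpectrum (𝓞 K), (ℓ : 𝓞 K) ∈ v.asIdeal →
        (((2 : ℤ) ^ Nv i) • cs i ∈
            (W.baseChange K).torsionLocalKer (v.adicCompletion K) ((2 ^ M : ℕ) : ℤ) ∧
          (Nv i ≠ 0 → ((2 : ℤ) ^ (Nv i - 1)) • cs i ∉
            (W.baseChange K).torsionLocalKer (v.adicCompletion K) ((2 ^ M : ℕ) : ℤ))) := by
  -- complex conjugation and its involutive lift to `K̄`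
  obtain ⟨c₀, hc₀⟩ := exists_isComplexConjugation (Rat.castHom ℝ)
  have ht : IsLiftOfAut cK (absGaloisTransport (K := ℚ) (L := K) c₀).toRingEquiv :=
    RatClosure.isLiftOfAut_absGaloisTransport_of_isImaginaryQuadratic hK hcK hc₀
  have hinv : ∀ x, (absGaloisTransport (K := ℚ) (L := K) c₀).toRingEquiv
      ((absGaloisTransport (K := ℚ) (L := K) c₀).toRingEquiv x) = x := fun x ↦
    RatClosure.absGaloisTransport_absGaloisTransport_of_sq_eq_one hc₀.sq_eq_one x
  -- a primitive cube root of unity, inverted by `τ`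
  obtain ⟨ω, hω⟩ : ∃ ω : AlgebraicClosure K, ω ^ 2 + ω + 1 = 0 := by
    obtain ⟨ω, hω⟩ := IsAlgClosed.exists_root
      (Polynomial.X ^ 2 + Polynomial.X + 1 : Polynomial (AlgebraicClosure K))
      (by rw [show (Polynomial.X ^ 2 + Polynomial.X + 1 : Polynomial (AlgebraicClosure K)).degree
        = 2 by compute_degree!]; norm_num)
    exact ⟨ω, by simpa [Polynomial.IsRoot] using hω⟩
  have hτω := transport_smul_eq_sq_of_cube_root (K := K) hc₀ hω
  -- Step B at `2` with the shear
  choose ν hν using hτ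
  obtain ⟨ρ, hρT, hρ⟩ := exists_h1Eval_conj_mul_order_two_shear W hCW hc hωK ht hinv hω hτω hM
    (fun i ↦ (hν i).1) (fun i ↦ (hν i).2) i₀ a ha ex hex hind Nv hNe hNM hN₀
  -- Steps C–G (Čebotarev, p-independent in the tree)
  obtain ⟨ℓ, hbℓ, hℓ, hℓN, hℓD, hℓp, hprime, hfrob, m, hm, hloc⟩ :=
    exists_kolyvaginPrime_gt_of_galoisElement (N := N) hC hK Nat.prime_two hc₀ ht hinv cs hρT b
  refine ⟨ℓ, hbℓ, hℓ, hℓN, hℓD, hℓp, hprime, hfrob, fun i v hv ↦ ?_⟩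
  have hρm : ρ * m ∈ torsionFixing (W.baseChange K) ((2 ^ M : ℕ) : ℤ) := mul_mem hρT hm.1
  have hF : ht.conjGalCMH (ρ * m) * (ρ * m) ∈ torsionFixing (W.baseChange K) ((2 ^ M : ℕ) : ℤ) :=
    mul_mem (ht.conjGalCMH_mem_torsionFixing W hinv _ hρm) hρm
  have hspan : ∀ k : ℤ, k • cs i ∈ AddSubgroup.closure (Set.range cs) := fun k ↦
    AddSubgroup.zsmul_mem _ (AddSubgroup.subset_closure (Set.mem_range_self i)) _
  obtain ⟨hA, hB⟩ := hρ m hm i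
  constructor
  · rw [hloc _ (hspan _) v hv, h1Eval_zsmul _ _ _ _ hF]
    exact hA
  · intro hN hmem
    rw [hloc _ (hspan _) v hv, h1Eval_zsmul _ _ _ _ hF] at hmem
    exact hB hN hmem

/-- **Cor. 3.2 at `2` with a shear, UNCONDITIONALLY** (Čebotarev discharged by the tree's
`Automorphic.chebotarev_artinRep_holds`). [cite: McCallumLMS1991, §3 Cor. 3.2] -/
theorem exists_kolyvaginPrime_gt_twoPow_shear_holds {N : ℕ} [NeZero N]
    (W : WeierstrassCurve ℚ) [W.IsElliptic] {C : VariableChange ℚ} {c : ℚ}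
    (hCW : C • W = ⟨0, 0, 0, 0, -c⟩) (hK : IsImaginaryQuadratic K)
    (hc : ∀ x : K, x ^ 3 ≠ (c : K)) (hωK : ∀ x : K, x ^ 2 + x + 1 ≠ 0)
    {M : ℕ} (hM : 1 ≤ M) {cK : K ≃ₐ[ℚ] K} (hcK : cK ≠ 1) {r : ℕ}
    (cs : Fin r → galH1Torsion (W.baseChange K) ((2 ^ M : ℕ) : ℤ))
    (hτ : ∀ i, ∃ e : ℤ, (e = 1 ∨ e = -1) ∧ conjAct W cK ((2 ^ M : ℕ) : ℤ) (cs i) = e • cs i)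
    (i₀ : Fin r) (a : Fin r → ℤ) (ha : a i₀ = 0)
    (ex : Fin r → ℕ) (hex : ∀ i, ((2 : ℤ) ^ ex i) • (cs i - a i • cs i₀) = 0)
    (hind : ∀ b : Fin r → ℤ, ∑ i, b i • (cs i - a i • cs i₀) = 0 → ∀ i, ((2 : ℤ) ^ ex i) ∣ b i)
    (Nv : Fin r → ℕ) (hNe : ∀ i, Nv i ≤ ex i) (hNM : ∀ i, Nv i ≤ M) (hN₀ : Nv i₀ = 0) (b : ℕ) :
    ∃ ℓ : ℕ, b < ℓ ∧ ℓ.Prime ∧ ¬ ℓ ∣ N ∧ ¬ ((ℓ : ℤ) ∣ NumberField.discr K) ∧ ℓ ≠ 2 ∧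
      (Ideal.span {(ℓ : 𝓞 K)}).IsPrime ∧ FrobEqFrobInfty W K (2 ^ M) ℓ ∧
      ∀ i, ∀ v : HeightOneSpectrum (𝓞 K), (ℓ : 𝓞 K) ∈ v.asIdeal →
        (((2 : ℤ) ^ Nv i) • cs i ∈
            (W.baseChange K).torsionLocalKer (v.adicCompletion K) ((2 ^ M : ℕ) : ℤ) ∧
          (Nv i ≠ 0 → ((2 : ℤ) ^ (Nv i - 1)) • cs i ∉
            (W.baseChange K).torsionLocalKer (v.adicCompletion K) ((2 ^ M : ℕ) : ℤ))) :=
  exists_kolyvaginPrime_gt_twoPow_shear (N := N)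
    Literature.NumberTheory.Automorphic.chebotarev_artinRep_holds W hCW hK hc hωK hM hcK cs hτ i₀ a ha
    ex hex hind Nv hNe hNM hN₀ b

/-! ## §3 The socle configuration of Claim B at `2` -/

/-- **The extra Čebotarev instance `hceb₁` of the parity-free descent, at `p = 2`, for
`E_W : y² = x³ − c` over `K` imaginary quadratic with `∛c ∉ K`, `ω ∉ K`** (given nothing: Čebotarev
is a tree theorem).  For `c`-eigenclasses `x, s ∈ H¹(K, E[2^M])^{ε}` and `d ∈ H¹(K, E[2^M])^{-ε}` with
`ℤ x ∩ ℤ s = 0`, `2^{M-1} x ≠ 0`, `ord s = 2^N` (`N ≠ 0`), `2^k d = 0`, `k ≥ 2`, and the SOCLE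
RELATION `2^{k-1} d = u · 2^{M-1} x` with `u` odd (so `ℤ d ∩ ℤ x ≠ 0` — the one configuration of
`…DescentDefect.exists_prime_stepB` that odd `p` never sees): above every bound `b` a prime `ℓ'`
(`ℓ' ∤ 2 N d_K`, inert, `Frob(ℓ') = Frob(∞)` on `K(E[2^M])`) with `x_{λ'} = 0`, `ord s_{λ'} = 2^N` and
`ord d_{λ'} = 2^{k-1}` — i.e. `2^{N-1} s_{λ'} ≠ 0`, `2^{k-2} d_{λ'} ≠ 0`.  Proof: the sheared family
`{x, s, d − u 2^{M-k} x}` is McCallum-independent with exponents `(M, N, k − 1)` (a relation gives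
`2 b₂ d = 0` by the signs, hence `2^{k-1} ∣ b₂`, and then `b₂ (d − u 2^{M-k} x) = 0` IS the socle
relation), so `exists_kolyvaginPrime_gt_twoPow_shear_holds` applies with targets `(0, N, k − 1)`.
[cite: McCallumLMS1991, §3 Cor. 3.2] [cite: GrossLMS1991, §10 Claim 10.3] -/
theorem exists_kolyvaginPrime_gt_twoPow_socle {N : ℕ} [NeZero N]
    (W : WeierstrassCurve ℚ) [W.IsElliptic] {C : VariableChange ℚ} {c : ℚ}
    (hCW : C • W = ⟨0, 0, 0, 0, -c⟩) (hK : IsImaginaryQuadratic K)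
    (hc : ∀ x : K, x ^ 3 ≠ (c : K)) (hωK : ∀ x : K, x ^ 2 + x + 1 ≠ 0)
    {M : ℕ} (hM : 1 ≤ M) {cK : K ≃ₐ[ℚ] K} (hcK : cK ≠ 1) {ε : ℤ} (hε : ε = 1 ∨ ε = -1)
    {x s d : galH1Torsion (W.baseChange K) ((2 ^ M : ℕ) : ℤ)}
    (hx : conjAct W cK ((2 ^ M : ℕ) : ℤ) x = ε • x) (hs : conjAct W cK ((2 ^ M : ℕ) : ℤ) s = ε • s)
    (hd : conjAct W cK ((2 ^ M : ℕ) : ℤ) d = (-ε) • d)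
    (x_ord : ((2 : ℤ) ^ (M - 1)) • x ≠ 0)
    (hind : ∀ a₀ a₁ : ℤ, a₀ • x + a₁ • s = 0 → a₁ • s = 0)
    {Ns : ℕ} (hNs0 : Ns ≠ 0) (hNs : ((2 : ℤ) ^ Ns) • s = 0) (hNs1 : ((2 : ℤ) ^ (Ns - 1)) • s ≠ 0)
    {k : ℕ} (hk2 : 2 ≤ k) (hk : ((2 : ℤ) ^ k) • d = 0) {u : ℤ} (hu : ¬ (2 : ℤ) ∣ u)
    (hrel : ((2 : ℤ) ^ (k - 1)) • d = u • (((2 : ℤ) ^ (M - 1)) • x)) (b : ℕ) :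
    ∃ ℓ : ℕ, b < ℓ ∧ ℓ.Prime ∧ ¬ ℓ ∣ N ∧ ¬ ((ℓ : ℤ) ∣ NumberField.discr K) ∧ ℓ ≠ 2 ∧
      (Ideal.span {(ℓ : 𝓞 K)}).IsPrime ∧ FrobEqFrobInfty W K (2 ^ M) ℓ ∧
      ∀ v : HeightOneSpectrum (𝓞 K), (ℓ : 𝓞 K) ∈ v.asIdeal →
        x ∈ (W.baseChange K).torsionLocalKer (v.adicCompletion K) ((2 ^ M : ℕ) : ℤ) ∧
        ((2 : ℤ) ^ (Ns - 1)) • s ∉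
          (W.baseChange K).torsionLocalKer (v.adicCompletion K) ((2 ^ M : ℕ) : ℤ) ∧
        ((2 : ℤ) ^ (k - 2)) • d ∉
          (W.baseChange K).torsionLocalKer (v.adicCompletion K) ((2 ^ M : ℕ) : ℤ) := by
  have he : ε * ε = 1 := by rcases hε with h | h <;> simp [h]
  -- every class is killed by `2^M`
  have hkillV : ∀ v : galH1Torsion (W.baseChange K) ((2 ^ M : ℕ) : ℤ), ((2 : ℤ) ^ M) • v = 0 :=
    fun v ↦ by exact_mod_cast zsmul_discreteH1_torsion ((2 ^ M : ℕ) : ℤ) v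
  have hkillV' : ∀ v : galH1Torsion (W.baseChange K) ((2 ^ M : ℕ) : ℤ),
      (((2 : ℕ) : ℤ) ^ M) • v = 0 := fun v ↦ by exact_mod_cast hkillV v
  -- powers above an exact exponent kill, as `(2 : ℤ)`-powers
  have hle_kill : ∀ {v : galH1Torsion (W.baseChange K) ((2 ^ M : ℕ) : ℤ)} {i j : ℕ}, i ≤ j →
      ((2 : ℤ) ^ i) • v = 0 → ((2 : ℤ) ^ j) • v = 0 := by
    intro v i j hij hv
    obtain ⟨r, rfl⟩ := Nat.exists_eq_add_of_le hij
    rw [add_comm, pow_add, mul_zsmul, hv, zsmul_zero]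
  -- exact orders of `x`, `s`, `d`
  have hxM : ((2 : ℤ) ^ M) • x = 0 := hkillV x
  have hk1 : ((2 : ℤ) ^ (k - 1)) • d ≠ 0 := by
    rw [hrel]
    intro h0
    -- `u` odd acts invertibly: `u • (2^{M-1} x) = 0 ⟹ 2^{M-1} x = 0`
    obtain ⟨w, hw⟩ := KolyvaginDescent.exists_mul_zsmul_eq_of_not_dvd (p := 2) Nat.prime_two
      hkillV' (β := u) (by exact_mod_cast hu)
    apply x_ord
    rw [← hw (((2 : ℤ) ^ (M - 1)) • x), mul_zsmul, h0, zsmul_zero]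
  have hkM : k ≤ M := by
    by_contra hlt
    exact hk1 (hle_kill (by omega) (hkillV d))
  have hNsM : Ns ≤ M := by
    by_contra hlt
    exact hNs1 (hle_kill (by omega) (hkillV s))
  have hxiff : ∀ m : ℤ, m • x = 0 ↔ ((2 : ℤ) ^ M) ∣ m := fun m ↦ by
    have h := KolyvaginDescent.zsmul_eq_zero_iff_prime_pow_dvd (p := 2) (M := M) Nat.prime_two
      (x := x) (by exact_mod_cast hxM) (by exact_mod_cast x_ord) m
    exact_mod_cast h
  have hsiff : ∀ m : ℤ, m • s = 0 ↔ ((2 : ℤ) ^ Ns) ∣ m := fun m ↦ by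
    have h := KolyvaginDescent.zsmul_eq_zero_iff_prime_pow_dvd (p := 2) (M := Ns) Nat.prime_two
      (x := s) (by exact_mod_cast hNs) (by exact_mod_cast hNs1) m
    exact_mod_cast h
  have hdiff : ∀ m : ℤ, m • d = 0 ↔ ((2 : ℤ) ^ k) ∣ m := fun m ↦ by
    have h := KolyvaginDescent.zsmul_eq_zero_iff_prime_pow_dvd (p := 2) (M := k) Nat.prime_two
      (x := d) (by exact_mod_cast hk) (by exact_mod_cast hk1) m
    exact_mod_cast h
  -- the shear coefficient `w = u · 2^{M-k}`: `2^{k-1} (d − w x) = 0`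
  set w : ℤ := u * (2 : ℤ) ^ (M - k) with hw
  have hpoww : (2 : ℤ) ^ (k - 1) * w = u * (2 : ℤ) ^ (M - 1) := by
    rw [hw, show (2 : ℤ) ^ (k - 1) * (u * (2 : ℤ) ^ (M - k)) =
      u * ((2 : ℤ) ^ (k - 1) * (2 : ℤ) ^ (M - k)) by ring, ← pow_add,
      show k - 1 + (M - k) = M - 1 by omega]
  have hshear : ((2 : ℤ) ^ (k - 1)) • (d - w • x) = 0 := by
    rw [zsmul_sub, hrel, smul_smul, smul_smul, hpoww, sub_self]
  -- the sheared family and its data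
  let cs : Fin 3 → galH1Torsion (W.baseChange K) ((2 ^ M : ℕ) : ℤ) := ![x, s, d]
  let a : Fin 3 → ℤ := ![0, 0, w]
  let ex : Fin 3 → ℕ := ![M, Ns, k - 1]
  let Nv : Fin 3 → ℕ := ![0, Ns, k - 1]
  have hτ : ∀ i, ∃ e : ℤ, (e = 1 ∨ e = -1) ∧ conjAct W cK ((2 ^ M : ℕ) : ℤ) (cs i) = e • cs i := by
    intro i
    fin_cases i
    · exact ⟨ε, hε, hx⟩
    · exact ⟨ε, hε, hs⟩
    · exact ⟨-ε, by rcases hε with h | h <;> simp [h], hd⟩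
  have hex : ∀ i, ((2 : ℤ) ^ ex i) • (cs i - a i • cs 0) = 0 := by
    intro i
    fin_cases i
    · change ((2 : ℤ) ^ M) • (x - (0 : ℤ) • x) = 0
      rw [zero_zsmul, sub_zero]
      exact hxM
    · change ((2 : ℤ) ^ Ns) • (s - (0 : ℤ) • x) = 0
      rw [zero_zsmul, sub_zero]
      exact hNs
    · exact hshear
  -- McCallum-independence of the sheared family with exponents `(M, Ns, k - 1)`
  have hkey : ∀ b₀ b₁ b₂ : ℤ, b₀ • x + b₁ • s + b₂ • (d - w • x) = 0 →
      ((2 : ℤ) ^ M) ∣ b₀ ∧ ((2 : ℤ) ^ Ns) ∣ b₁ ∧ ((2 : ℤ) ^ (k - 1)) ∣ b₂ := by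
    intro b₀ b₁ b₂ hb
    -- the signs give `2 b₂ d = 0`
    have hrel' : (b₀ - b₂ * w) • x + b₁ • s + b₂ • d = 0 := by
      have e1 : (b₀ - b₂ * w) • x + b₁ • s + b₂ • d = b₀ • x + b₁ • s + b₂ • (d - w • x) := by
        rw [sub_zsmul, zsmul_sub, mul_zsmul]
        abel
      rw [e1]
      exact hb
    have hτrel : (ε * (b₀ - b₂ * w)) • x + (ε * b₁) • s + (-(ε * b₂)) • d = 0 := by
      have := congrArg (conjAct W cK ((2 ^ M : ℕ) : ℤ)) hrel'
      rw [map_add, map_add, map_zsmul, map_zsmul, map_zsmul, map_zero, hx, hs, hd, smul_smul,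
        smul_smul, smul_smul, mul_neg, mul_comm (b₀ - b₂ * w) ε, mul_comm b₁ ε, mul_comm b₂ ε]
        at this
      exact this
    have h3 : (ε * (b₀ - b₂ * w)) • x + (ε * b₁) • s + (ε * b₂) • d = 0 := by
      have := congrArg (fun v ↦ ε • v) hrel'
      rwa [zsmul_add, zsmul_add, smul_smul, smul_smul, smul_smul, zsmul_zero] at this
    have h4 : (2 * (ε * b₂)) • d = 0 := by
      have e1 : (2 * (ε * b₂)) • d =
          ((ε * (b₀ - b₂ * w)) • x + (ε * b₁) • s + (ε * b₂) • d) -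
            ((ε * (b₀ - b₂ * w)) • x + (ε * b₁) • s + (-(ε * b₂)) • d) := by
        rw [neg_zsmul, two_mul, add_zsmul]
        abel
      rw [e1, h3, hτrel, sub_zero]
    have h2 : ((2 : ℤ) * b₂) • d = 0 := by
      have := congrArg (fun v ↦ ε • v) h4
      rwa [smul_smul, zsmul_zero, show ε * (2 * (ε * b₂)) = (ε * ε) * (2 * b₂) by ring, he,
        one_mul] at this
    -- so `2^{k-1} ∣ b₂`, and the `d`-term of `hb` is the socle relation, i.e. vanishes
    have hb2 : ((2 : ℤ) ^ (k - 1)) ∣ b₂ := by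
      have h := (hdiff _).mp h2
      rw [show (2 : ℤ) ^ k = 2 * (2 : ℤ) ^ (k - 1) by
        rw [← pow_succ']; congr 1; omega] at h
      exact (mul_dvd_mul_iff_left (two_ne_zero (α := ℤ))).mp h
    have hb2term : b₂ • (d - w • x) = 0 := by
      obtain ⟨q, hq⟩ := hb2
      rw [hq, mul_comm, mul_zsmul, hshear, zsmul_zero]
    rw [hb2term, add_zero] at hb
    have hb1 : b₁ • s = 0 := hind _ _ hb
    have hb0 : b₀ • x = 0 := by rwa [hb1, add_zero] at hb
    exact ⟨(hxiff _).mp hb0, (hsiff _).mp hb1, hb2⟩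
  have hind3 : ∀ bv : Fin 3 → ℤ, ∑ i, bv i • (cs i - a i • cs 0) = 0 →
      ∀ i, ((2 : ℤ) ^ ex i) ∣ bv i := by
    intro bv hb i
    rw [Fin.sum_univ_three] at hb
    simp only [cs, a, Matrix.cons_val_zero, Matrix.cons_val_one, Matrix.cons_val, zero_zsmul,
      sub_zero] at hb
    obtain ⟨h0, h1, h2⟩ := hkey (bv 0) (bv 1) (bv 2) hb
    fin_cases i
    · simpa [ex] using h0
    · simpa [ex] using h1
    · simpa [ex] using h2
  have hNe : ∀ i, Nv i ≤ ex i := fun i ↦ by fin_cases i <;> simp [Nv, ex]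
  have hNM : ∀ i, Nv i ≤ M := fun i ↦ by
    fin_cases i
    · simp [Nv]
    · simpa [Nv] using hNsM
    · simp only [Nv]
      change k - 1 ≤ M
      omega
  obtain ⟨ℓ, hbℓ, hℓ, hℓN, hℓD, hℓ2, hprime, hfrob, hloc⟩ :=
    exists_kolyvaginPrime_gt_twoPow_shear_holds (N := N) W hCW hK hc hωK hM hcK cs hτ 0 a
      (by simp [a]) ex hex hind3 Nv hNe hNM (by simp [Nv]) b
  refine ⟨ℓ, hbℓ, hℓ, hℓN, hℓD, hℓ2, hprime, hfrob, fun v hv ↦ ⟨?_, ?_, ?_⟩⟩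
  · have h0 := (hloc 0 v hv).1
    change ((2 : ℤ) ^ 0) • x ∈ _ at h0
    rwa [pow_zero, one_zsmul] at h0
  · have h1 := (hloc 1 v hv).2 (by change Ns ≠ 0; exact hNs0)
    change ((2 : ℤ) ^ (Ns - 1)) • s ∉ _ at h1
    exact h1
  · have h2 := (hloc 2 v hv).2 (by change k - 1 ≠ 0; omega)
    change ((2 : ℤ) ^ (k - 1 - 1)) • d ∉ _ at h2
    rwa [show k - 1 - 1 = k - 2 by omega] at h2

end Summit.BirchSwinnertonDyer.BirchSwinnertonDyer.Theorems.SylvesterTwoUpper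

end
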